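import Literature.AlgebraicGeometry.HodgeTheory.RationalHodgeClasses
import Literature.AlgebraicGeometry.HodgeTheory.TopDegreeClasses
import HarnessLib

/-!
# Hodge models of smooth projective varieties are connected

Family `hodge`, layer `Literature/AlgebraicGeometry/HodgeTheory`. A two-lemma glue file: the
carrier `M ≅ X^an` of a Hodge model (`HodgeModel`, file `RationalHodgeClasses`) of a smooth projective,
geometrically irreducible `X/ℂ` is a connected (hence non-empty) topological space. This is the
tree's `connectedSpace_complexPoints` (file `TopDegreeClasses`: irreducible varieties are connected
in the complex topology, SGA1 XII Prop. 2.4, proved there from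
`ComplexPoints.isConnected_setOf_pt_mem_of_isIrreducible_holds`), transported along the homeomorphism
`M ≃ₜ X(ℂ)` underlying the analytification (`IsAnalytification.homeomorph`).

Consumers: arguments on a Hodge model that invoke the identity theorem for analytic sets
(`Literature.Geometry.Kaehler.IsAnalyticSet.interior_eq_empty_holds` and
`HolomorphicLineBundle.GlobalSection.zeroSet_union_zeroSet_ne_univ` need `[ConnectedSpace M]`), e.g.
the meromorphic-section reduction of `lineBundle_isTrivialOn_compl_analyticSet`
(`LefschetzOneOneChernWeil`). Compactness of the carrier is `HodgeModel.compactSpace_carrier`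
(file `HypersurfaceHolomorphicForms`); the argument order `(A) (hX)` follows it.

## References

* A. Grothendieck, M. Raynaud, *SGA 1*, Exp. XII, Prop. 2.4.
* J.-P. Serre, *GAGA*, Ann. Inst. Fourier 6 (1956), §2 (the analytification).
-/

noncomputable section

namespace Literature.AlgebraicGeometry.HodgeTheory

section HodgeTheory

variable {n : ℕ} {X : Motives.SchemeOver ℂ}

/-- **The analytification of a smooth projective variety is connected**: the carrier `M ≅ X^an` of
a Hodge model of a smooth projective (geometrically irreducible) `X/ℂ` is a connected space — the
tree's `connectedSpace_complexPoints` (irreducible varieties are connected in the complex topology,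
SGA1 XII Prop. 2.4) transported along the homeomorphism `M ≃ₜ X(ℂ)` underlying the analytification.
[cite: SGA1, Exp. XII Prop. 2.4] -/
theorem HodgeModel.connectedSpace_carrier (A : HodgeModel n X)
    (hX : Motives.IsSmoothProjective n X) : ConnectedSpace A.carrier := by
  haveI : ConnectedSpace (Motives.ComplexPoints X) := connectedSpace_complexPoints hX
  exact A.isAnalytification.homeomorph.symm.surjective.connectedSpace
    A.isAnalytification.homeomorph.symm.continuous

/-- In particular the carrier of a Hodge model of a smooth projective variety is non-empty.
[cite: SGA1, Exp. XII Prop. 2.4] -/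
theorem HodgeModel.nonempty_carrier (A : HodgeModel n X) (hX : Motives.IsSmoothProjective n X) :
    Nonempty A.carrier :=
  (A.connectedSpace_carrier hX).toNonempty

/-- The carrier of a Hodge model of a smooth projective variety is preconnected (as a set: `univ`
is preconnected), the form consumed by `IsPreconnected`-phrased statements. [cite: SGA1, Exp. XII Prop. 2.4] -/
theorem HodgeModel.isPreconnected_univ_carrier (A : HodgeModel n X)
    (hX : Motives.IsSmoothProjective n X) : IsPreconnected (Set.univ : Set A.carrier) :=
  haveI := A.connectedSpace_carrier hX
  isPreconnected_univ

end HodgeTheory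

end Literature.AlgebraicGeometry.HodgeTheory
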